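import Literature.AlgebraicGeometry.HodgeTheory.CorrespondenceComposition
import Literature.AlgebraicGeometry.HodgeTheory.ComplexGysinRational
import Literature.AlgebraicGeometry.HodgeTheory.GysinKernelProofs
import Literature.AlgebraicTopology.SingularHomology.UniversalCoefficientsField
import Mathlib.LinearAlgebra.Dual.Lemmas
import HarnessLib

/-!
# Gysin base change for the product square `X ⊗ (Y ⊗ Z) → Y ⊗ Z` over `X ⊗ Y → Y`, from the
# Künneth spanning property

Family `hodge`, layer `Literature/AlgebraicGeometry/HodgeTheory`. Companion to
`CorrespondenceComposition` (composition of correspondences `[γ'']_* = [γ]_* ∘ [γ']_*`, Fulton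
§16.1 / Buskin Lemma 6.3, proved there GRANTED the Gysin base change `hBC` for the cartesian square
of projections

  `X ⊗ (Y ⊗ Z) —p₂₃ = snd→ Y ⊗ Z`
  `     | p₁₂ = X ◁ fst        | fst`
  `   X ⊗ Y   ———— snd ———→    Y`,       `snd_{X,Y}^* ∘ (fst_{Y,Z})_* = c • (p₁₂)_* ∘ p₂₃^*`,

"for closed oriented manifolds … it follows from the Künneth formula / `[M × N] = [M] × [N]`,
absent for the tree's singular (co)homology"). This file PROVES that base change
(`gysin_baseChange_of_kunneth`, in exactly the shape of that hypothesis, with an explicit scalar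
`c`) from the SPANNING half of the Künneth formula alone — every class on `(Y' ⊗ Z')(ℂ)` is a
`ℂ`-linear combination of cross products `fst^* b ∪ snd^* w` (Hatcher, *Algebraic Topology*,
Thm. 3.15 with Cor. A.12; hypothesis `hK`, used for the pairs `(Y, Z)` and `(X, Y ⊗ Z)`) — and the
tree's Poincaré duality formalism (`ComplexGysin`, `GysinMap`, `CapProduct`, universal coefficients
over a field):

* `complexGysin_cup_map_eq_zero_of_lt` — `f_*(f^* u ∪ v) = 0` whenever `deg v < 2 (dim E - dim B)`
  (`f : E ⟶ B`): `f_*` is `D_B⁻¹ ∘ f(ℂ)_* ∘ D_E`, and `f(ℂ)_* (v ⌢ [E(ℂ)])` lies in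
  `H_{2 dim E - deg v}(B(ℂ)) = 0` (Hatcher Thm. 3.26 (c) / Prop. 3.29);
* `exists_eq_smul_one` — `H⁰(X(ℂ); ℂ) = ℂ · 1` (`X(ℂ)` is connected, SGA1 XII 2.4, so
  `H_{2n}(X(ℂ); ℂ) = ℂ · [X(ℂ)]`, Hatcher Thm. 3.26, and `⌢ [X(ℂ)]` is injective);
* `exists_eq_smul_of_top` — `H²ⁿ(Z(ℂ); ℂ)` is a line (universal coefficients, Hatcher Thm. 3.2);
* `exists_complexGysin_map_ne_zero` — for some `w ∈ H²ⁿ(Z(ℂ))`, `(p₁₂)_* (p₂₃^* snd^* w) ≠ 0` in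
  `H⁰((X ⊗ Y)(ℂ))` (the Künneth spanning in the top degree of `X ⊗ (Y ⊗ Z)` and of `Y ⊗ Z` produces
  a cross product `p₁₂^* ω ∪ p₃^* w` pairing non-trivially with `[(X ⊗ (Y ⊗ Z))(ℂ)]`, and
  `⟨p₁₂^* ω ∪ p₃^* w, [T]⟩ = ⟨ω, (p₁₂)_* p₃^* w ⌢ [X ⊗ Y]⟩`);
* `gysin_baseChange_of_kunneth` — the base change: both sides are `ℂ`-linear in `z`, so it is
  checked on cross products `fst^* b ∪ snd^* w` (`LinearMap.eqOn_span`); for `deg w < 2 dim Z` both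
  sides vanish, for `deg w > 2 dim Z` `w = 0`, and for `deg w = 2 dim Z` the projection formula
  (`complexGysin_cup`) reduces both sides to `snd^* b ∪ (degree-0 class)`, the two degree-`0`
  classes `snd^*(fst_* snd^* w)` and `(p₁₂)_*(p₃^* w)` being proportional multiples of `1`,
  uniformly in `w` (they are linear in `w ∈ H²ⁿ(Z(ℂ)) ≅ ℂ` and the second one is non-zero for
  some `w`).

With it, `corr_comp_of_baseChange` needs only the Künneth spanning property. (The same proof is
kernel-checked Summits-side as
`Summit.HodgeConjecture.HodgeConjecture.Theorems.NikulinTwinTransport.gysin_baseChange_of_kunneth`.)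

## References

* [Fulton1998] W. Fulton, Intersection Theory, 2nd ed., Springer 1998, Prop. 1.7, §16.1.
* [FultonYoungTableaux1997] W. Fulton, Young Tableaux, CUP 1997, Appendix B §B.1 (4)–(6).
* [HatcherAT2002] A. Hatcher, Algebraic Topology, CUP 2002, §3.1 Thm. 3.2, §3.2 Thm. 3.15,
  §3.3 Thm. 3.26, Thm. 3.30, Cor. A.12.
* [Buskin2019] N. Buskin, Every rational Hodge isometry between two K3 surfaces is algebraic,
  J. reine angew. Math. 755 (2019), Lemma 6.3.
-/

noncomputable section

open CategoryTheory AlgebraicGeometry MonoidalCategory CartesianMonoidalCategory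
open Literature.AlgebraicGeometry.Motives
open Literature.AlgebraicTopology.SingularHomology

namespace Literature.AlgebraicGeometry.HodgeTheory

section HodgeTheory

variable {μ : OrientationFamily} {l m n : ℕ} {X Y Z : SchemeOver ℂ}

/-! ### Vanishing of `f_*(f^* u ∪ v)` below the fibre dimension -/

/-- **`f_*(f^* u ∪ v) = 0` for `deg v < 2 (dim E - dim B)`** (`f : E ⟶ B` a morphism of smooth
projective varieties of dimensions `e`, `b`; `u ∈ Hⁱ(B(ℂ))`, `v ∈ Hᵏ(E(ℂ))`, `k + 2b < 2e`): by the
defining square `f_* x ⌢ [B] = f(ℂ)_* (x ⌢ [E])` and `(f^* u ∪ v) ⌢ [E] = ± f^* u ⌢ (v ⌢ [E])`,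
`f_*(f^* u ∪ v) ⌢ [B] = ± u ⌢ f(ℂ)_*(v ⌢ [E])` with `f(ℂ)_*(v ⌢ [E]) ∈ H_{2e-k}(B(ℂ)) = 0`
(`2e - k > 2b`, Hatcher Thm. 3.26 (c)); conclude by the injectivity of `⌢ [B]` (Poincaré duality).
[cite: FultonYoungTableaux1997, Appendix B §B.1 (5)] [cite: HatcherAT2002, §3.3 Thm. 3.26 and Thm. 3.30] -/
theorem complexGysin_cup_map_eq_zero_of_lt {e b : ℕ} {E B : SchemeOver ℂ}
    (hE : IsSmoothProjective e E) (hB : IsSmoothProjective b B) (f : E ⟶ B) {i k d d₁ : ℕ}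
    (hik : i + k = d) (hd : d + 2 * b = d₁ + 2 * e) (hk : k + 2 * b < 2 * e)
    (u : complexBetti B i) (v : complexBetti E k) :
    complexGysin μ hE hB f hd (cupProduct hik (complexBetti.map f i u) v) = 0 := by
  have hμ : μ.HasPoincareDuality := OrientationFamily.hasPoincareDuality μ
  by_cases hle : d ≤ 2 * e
  swap
  · haveI := subsingleton_complexBetti hE (show 2 * e < d by omega)
    rw [Subsingleton.elim (cupProduct hik (complexBetti.map f i u) v) 0, map_zero]
  -- `q = 2e - d` is the homological degree through which `f_*` factors
  obtain ⟨q, hq⟩ : ∃ q, d + q = 2 * e := ⟨2 * e - d, by omega⟩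
  have hb' : d₁ + q = 2 * b := by omega
  apply (hμ hB hb').1
  rw [map_zero, poincareDualityMap_apply, capProduct_complexGysin hμ hE hB f hd hq hb',
    cupProduct_gradedComm_holds ℂ _ hik (show k + i = d by omega) _ v, map_smul, LinearMap.smul_apply,
    map_smul, cupProduct_capProduct (show k + i = d by omega) hq (show i + q = i + q from rfl)
      (show k + (i + q) = 2 * e by omega)]
  change _ • singularHomology.map ℂ ℂ (AlgPoints.mapContinuous (L := ℂ) f) q
    (capProduct rfl (singularCohomology.map ℂ ℂ (AlgPoints.mapContinuous (L := ℂ) f) i u) _) = 0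
  rw [capProduct_map]
  have h0 : singularHomology.map ℂ ℂ (AlgPoints.mapContinuous (L := ℂ) f) (i + q)
      (capProduct (show k + (i + q) = 2 * e by omega) v (μ hE).fundamentalClass) = 0 := by
    haveI := ModuleCat.subsingleton_of_isZero
      (ComplexPoints.isZero_singularHomology_of_lt hB ℂ ℂ (show 2 * b < i + q by omega))
    exact Subsingleton.elim _ _
  rw [h0, map_zero, smul_zero]

/-! ### Degree-zero classes and top-degree classes are lines -/

/-- **`H⁰(X(ℂ); ℂ) = ℂ · 1`** for `X` smooth projective of dimension `n`: `X(ℂ)` is a closed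
connected `2n`-manifold, so `u ⌢ [X(ℂ)] ∈ H_{2n}(X(ℂ); ℂ) = ℂ · [X(ℂ)]` (Hatcher Thm. 3.26),
`= t • (1 ⌢ [X(ℂ)])`, and `⌢ [X(ℂ)]` is injective (Thm. 3.30).
[cite: HatcherAT2002, §3.3 Thm. 3.26 and Thm. 3.30] [cite: SGA1, Exp. XII Prop. 2.4] -/
theorem exists_eq_smul_one (μ : OrientationFamily) (hX : IsSmoothProjective n X) (u : complexBetti X 0) :
    ∃ t : ℂ, u = t • singularCohomology.one ℂ (ComplexPoints X) := by
  have hμ : μ.HasPoincareDuality := OrientationFamily.hasPoincareDuality μ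
  letI := hX.chartedSpace
  haveI := ComplexPoints.compactSpace_of_isSmoothProjective hX
  haveI := ComplexPoints.t2Space_of_isSmoothProjective hX
  haveI := connectedSpace_complexPoints hX
  obtain ⟨t, ht⟩ := exists_eq_smul_fundamentalClass_of_connectedSpace (μ hX)
    (capProduct (Nat.zero_add (2 * n)) u (μ hX).fundamentalClass)
  refine ⟨t, (hμ hX (Nat.zero_add (2 * n))).1 ?_⟩
  rw [poincareDualityMap_apply, poincareDualityMap_apply, ht, map_smul, LinearMap.smul_apply,
    one_capProduct]

/-- **`H²ⁿ(Z(ℂ); ℂ)` is a line**: if `w₁ ≠ 0` then every `w` is `t • w₁` (universal coefficients over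
a field, Hatcher Thm. 3.2: `H²ⁿ ≅ Hom(H₂ₙ, ℂ)`, and `H₂ₙ(Z(ℂ); ℂ) = ℂ · [Z(ℂ)]`, Thm. 3.26).
[cite: HatcherAT2002, §3.1 Thm. 3.2 and §3.3 Thm. 3.26] -/
theorem exists_eq_smul_of_top (μ : OrientationFamily) (hZ : IsSmoothProjective n Z)
    {w₁ : complexBetti Z (2 * n)} (hw₁ : w₁ ≠ 0) (w : complexBetti Z (2 * n)) :
    ∃ t : ℂ, w = t • w₁ := by
  letI := hZ.chartedSpace
  haveI := ComplexPoints.compactSpace_of_isSmoothProjective hZ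
  haveI := ComplexPoints.t2Space_of_isSmoothProjective hZ
  haveI := connectedSpace_complexPoints hZ
  have hinj := kroneckerPairing_injective_of_field ℂ (ComplexPoints Z) (2 * n)
  set κ := kroneckerPairing ℂ ℂ (ComplexPoints Z) (2 * n) with hκ
  -- a functional on the line `H₂ₙ = ℂ · [Z]` is determined by its value on `[Z]`
  have hdet : ∀ v : complexBetti Z (2 * n), κ v (μ hZ).fundamentalClass = 0 → v = 0 := by
    intro v hv
    apply hinj
    rw [map_zero]
    refine LinearMap.ext fun z ↦ ?_
    obtain ⟨r, rfl⟩ := exists_eq_smul_fundamentalClass_of_connectedSpace (μ hZ) z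
    rw [map_smul, hv, smul_zero, LinearMap.zero_apply]
  have h₁ : κ w₁ (μ hZ).fundamentalClass ≠ 0 := fun h ↦ hw₁ (hdet w₁ h)
  refine ⟨κ w (μ hZ).fundamentalClass * (κ w₁ (μ hZ).fundamentalClass)⁻¹, ?_⟩
  rw [← sub_eq_zero]
  apply hdet
  rw [map_sub, map_smul, LinearMap.sub_apply, LinearMap.smul_apply, smul_eq_mul,
    inv_mul_cancel_right₀ h₁, sub_self]

/-! ### A fibre integral that does not vanish -/

/-- **For some `w ∈ H²ⁿ(Z(ℂ))`, `(p₁₂)_* (p₂₃^* snd^* w) ≠ 0` in `H⁰((X ⊗ Y)(ℂ))`**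
(`p₁₂ = X ◁ fst : X ⊗ (Y ⊗ Z) → X ⊗ Y`, `p₂₃ = snd`), GRANTED the Künneth spanning property in the
top degree of `T = X ⊗ (Y ⊗ Z)` and of `Y ⊗ Z`: some top-degree class of `T(ℂ)` pairs non-trivially
with `[T(ℂ)]` (universal coefficients over `ℂ`, `[T(ℂ)] ≠ 0`), hence so does some cross product,
which for degree reasons is `fst^* a ∪ snd^*(fst^* b ∪ snd^* w)` with `a, b, w` of top degree, i.e.
`p₁₂^* ω ∪ p₂₃^* snd^* w` with `ω = fst^* a ∪ snd^* b`; and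
`⟨p₁₂^* ω ∪ t, [T]⟩ = ⟨t ∪ p₁₂^* ω, [T]⟩ = ⟨p₁₂^* ω, t ⌢ [T]⟩ = ⟨ω, p₁₂(ℂ)_* (t ⌢ [T])⟩ = ⟨ω, (p₁₂)_* t ⌢ [X ⊗ Y]⟩`.
[cite: HatcherAT2002, §3.2 Thm. 3.15 and §3.1 Thm. 3.2] [cite: FultonYoungTableaux1997, Appendix B §B.1 (5)] -/
theorem exists_complexGysin_map_ne_zero (μ : OrientationFamily)
    (hX : IsSmoothProjective l X) (hY : IsSmoothProjective m Y) (hZ : IsSmoothProjective n Z)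
    (hKT : ∀ z : complexBetti (X ⊗ (Y ⊗ Z)) (2 * (l + (m + n))), z ∈ Submodule.span ℂ
      {v | ∃ (i j : ℕ) (h : i + j = 2 * (l + (m + n))) (a : complexBetti X i)
        (w : complexBetti (Y ⊗ Z) j),
        v = cupProduct h (complexBetti.map (fst X (Y ⊗ Z)) i a)
          (complexBetti.map (snd X (Y ⊗ Z)) j w)})
    (hKYZ : ∀ z : complexBetti (Y ⊗ Z) (2 * (m + n)), z ∈ Submodule.span ℂ
      {v | ∃ (i j : ℕ) (h : i + j = 2 * (m + n)) (b : complexBetti Y i) (w : complexBetti Z j),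
        v = cupProduct h (complexBetti.map (fst Y Z) i b) (complexBetti.map (snd Y Z) j w)}) :
    ∃ w : complexBetti Z (2 * n),
      complexGysin μ (IsSmoothProjective.tensor_holds hX (IsSmoothProjective.tensor_holds hY hZ))
        (IsSmoothProjective.tensor_holds hX hY) (X ◁ fst Y Z)
        (show 2 * n + 2 * (l + m) = 0 + 2 * (l + (m + n)) by omega)
        (complexBetti.map (snd X (Y ⊗ Z)) (2 * n) (complexBetti.map (snd Y Z) (2 * n) w)) ≠ 0 := by
  have hμ : μ.HasPoincareDuality := OrientationFamily.hasPoincareDuality μ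
  have hYZ := IsSmoothProjective.tensor_holds hY hZ
  have hXY := IsSmoothProjective.tensor_holds hX hY
  have hT := IsSmoothProjective.tensor_holds hX hYZ
  letI := hT.chartedSpace
  haveI := ComplexPoints.compactSpace_of_isSmoothProjective hT
  haveI := ComplexPoints.t2Space_of_isSmoothProjective hT
  haveI := connectedSpace_complexPoints hT
  -- a top-degree class of `T(ℂ)` pairing non-trivially with `[T(ℂ)]`
  set κ := kroneckerPairing ℂ ℂ (ComplexPoints (X ⊗ (Y ⊗ Z))) (2 * (l + (m + n))) with hκ
  have hne : (μ hT).fundamentalClass ≠ 0 := fundamentalClass_ne_zero (μ hT)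
  obtain ⟨φ, hφ⟩ : ∃ φ : Module.Dual ℂ (singularHomology ℂ ℂ (ComplexPoints (X ⊗ (Y ⊗ Z)))
      (2 * (l + (m + n)))), φ (μ hT).fundamentalClass ≠ 0 := by
    by_contra h
    push Not at h
    exact hne ((Module.forall_dual_apply_eq_zero_iff ℂ _).1 h)
  obtain ⟨G₀, hG₀⟩ := kroneckerPairing_surjective ℂ (ComplexPoints (X ⊗ (Y ⊗ Z))) (2 * (l + (m + n))) φ
  have hG₀ne : κ G₀ (μ hT).fundamentalClass ≠ 0 := by rw [hκ, hG₀]; exact hφ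
  by_contra hall
  push Not at hall
  apply hG₀ne
  -- the pairing with `[T]` kills every cross product `p₁₂^* ω ∪ p₂₃^* snd^* w`, `ω` of top degree
  have key : ∀ (ω : complexBetti (X ⊗ Y) (2 * (l + m))) (w : complexBetti Z (2 * n)),
      κ (cupProduct (show 2 * (l + m) + 2 * n = 2 * (l + (m + n)) by omega)
        (complexBetti.map (X ◁ fst Y Z) (2 * (l + m)) ω)
        (complexBetti.map (snd X (Y ⊗ Z)) (2 * n) (complexBetti.map (snd Y Z) (2 * n) w)))
        (μ hT).fundamentalClass = 0 := by
    intro ω w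
    have hsign : ((-1 : ℂ) ^ (2 * (l + m) * (2 * n))) = 1 :=
      Even.neg_one_pow ⟨(l + m) * (2 * n), by ring⟩
    rw [cupProduct_gradedComm_holds ℂ _ _ (show 2 * n + 2 * (l + m) = 2 * (l + (m + n)) by omega),
      hsign, one_smul, hκ, kroneckerPairing_cupProduct]
    change kroneckerPairing ℂ ℂ _ _ (singularCohomology.map ℂ ℂ
      (AlgPoints.mapContinuous (L := ℂ) (X ◁ fst Y Z)) _ ω) _ = 0
    rw [kroneckerPairing_map, ← capProduct_complexGysin hμ hT hXY (X ◁ fst Y Z)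
      (show 2 * n + 2 * (l + m) = 0 + 2 * (l + (m + n)) by omega) _ (Nat.zero_add _), hall w,
      map_zero, LinearMap.zero_apply, map_zero]
  -- hence (Künneth spanning, twice) it kills everything
  have hle : Submodule.span ℂ {v | ∃ (i j : ℕ) (h : i + j = 2 * (l + (m + n))) (a : complexBetti X i)
        (w : complexBetti (Y ⊗ Z) j),
        v = cupProduct h (complexBetti.map (fst X (Y ⊗ Z)) i a)
          (complexBetti.map (snd X (Y ⊗ Z)) j w)} ≤
      LinearMap.ker (κ.flip (μ hT).fundamentalClass) := by
    refine Submodule.span_le.2 ?_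
    rintro _ ⟨i, j, h, a, v, rfl⟩
    rw [SetLike.mem_coe, LinearMap.mem_ker, LinearMap.flip_apply]
    rcases lt_trichotomy (2 * l) i with hi | hi | hi
    · haveI := subsingleton_complexBetti hX hi
      rw [Subsingleton.elim a 0, map_zero, map_zero, LinearMap.zero_apply, map_zero,
        LinearMap.zero_apply]
    swap
    · haveI := subsingleton_complexBetti hYZ (show 2 * (m + n) < j by omega)
      rw [Subsingleton.elim v 0, map_zero, map_zero, map_zero, LinearMap.zero_apply]
    subst hi
    obtain rfl : j = 2 * (m + n) := by omega
    -- the inner Künneth spanning, for `v ∈ H^{2(m+n)}((Y ⊗ Z)(ℂ))`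
    let Ψ : complexBetti (Y ⊗ Z) (2 * (m + n)) →ₗ[ℂ] ℂ :=
      κ.flip (μ hT).fundamentalClass ∘ₗ
        cupProduct h (complexBetti.map (fst X (Y ⊗ Z)) (2 * l) a) ∘ₗ
        (complexBetti.map (snd X (Y ⊗ Z)) (2 * (m + n))).hom
    have hΨ : Submodule.span ℂ {v | ∃ (i j : ℕ) (h : i + j = 2 * (m + n)) (b : complexBetti Y i)
        (w : complexBetti Z j),
        v = cupProduct h (complexBetti.map (fst Y Z) i b) (complexBetti.map (snd Y Z) j w)} ≤
        LinearMap.ker Ψ := by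
      refine Submodule.span_le.2 ?_
      rintro _ ⟨i', j', h', b, w, rfl⟩
      rw [SetLike.mem_coe, LinearMap.mem_ker]
      change κ (cupProduct h (complexBetti.map (fst X (Y ⊗ Z)) (2 * l) a)
        (complexBetti.map (snd X (Y ⊗ Z)) (2 * (m + n))
          (cupProduct h' (complexBetti.map (fst Y Z) i' b) (complexBetti.map (snd Y Z) j' w))))
        (μ hT).fundamentalClass = 0
      rcases lt_trichotomy (2 * m) i' with hi' | hi' | hi'
      · haveI := subsingleton_complexBetti hY hi'
        rw [Subsingleton.elim b 0, map_zero, map_zero, LinearMap.zero_apply, map_zero, map_zero,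
          map_zero, LinearMap.zero_apply]
      swap
      · haveI := subsingleton_complexBetti hZ (show 2 * n < j' by omega)
        rw [Subsingleton.elim w 0, map_zero, map_zero, map_zero, map_zero, map_zero,
          LinearMap.zero_apply]
      subst hi'
      obtain rfl : j' = 2 * n := by omega
      -- `fst^* a ∪ snd^*(fst^* b ∪ snd^* w) = p₁₂^*(fst^* a ∪ snd^* b) ∪ p₂₃^* snd^* w`
      rw [cupProduct_map]
      have e₁ : complexBetti.map (snd X (Y ⊗ Z)) (2 * m) (complexBetti.map (fst Y Z) (2 * m) b) =
          complexBetti.map (X ◁ fst Y Z) (2 * m) (complexBetti.map (snd X Y) (2 * m) b) := by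
        rw [← CategoryTheory.comp_apply, ← complexBetti.map_comp, ← whiskerLeft_snd,
          complexBetti.map_comp, CategoryTheory.comp_apply]
      have e₂ : complexBetti.map (fst X (Y ⊗ Z)) (2 * l) a =
          complexBetti.map (X ◁ fst Y Z) (2 * l) (complexBetti.map (fst X Y) (2 * l) a) := by
        rw [← CategoryTheory.comp_apply, ← complexBetti.map_comp, whiskerLeft_fst]
      rw [e₁, e₂, ← cupProduct_assoc (show 2 * l + 2 * m = 2 * (l + m) by omega) h'
        (show 2 * (l + m) + 2 * n = 2 * (l + (m + n)) by omega) h, ← cupProduct_map]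
      exact key _ w
    exact hΨ (hKYZ v)
  exact hle (hKT G₀)

/-! ### Gysin base change for the product square -/

/-- **Gysin base change for the cartesian square of projections, from the Künneth spanning
property.** For smooth projective complex `X, Y, Z` (dimensions `l, m, n`), an orientation family
`μ` and degrees `k + 2m = k₁ + 2(m + n)`, there is `c ∈ ℂ` with

  `snd_{X,Y}^* ((fst_{Y,Z})_* z) = c • (X ◁ fst_{Y,Z})_* (snd_{X, Y ⊗ Z}^* z)`  for all `z ∈ Hᵏ((Y ⊗ Z)(ℂ))`

— the hypothesis `hBC` of `Literature.AlgebraicGeometry.HodgeTheory.corr_comp_of_baseChange` —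
GRANTED that every class on a product `(Y' ⊗ Z')(ℂ)` of smooth projective varieties is a `ℂ`-linear
combination of cross products `fst^* b ∪ snd^* w` (`hK`, the spanning half of the Künneth formula,
Hatcher Thm. 3.15 with Cor. A.12; used for `(Y, Z)` and `(X, Y ⊗ Z)`). Both sides are linear in `z`,
so the identity is checked on cross products (`LinearMap.eqOn_span`): for `deg w < 2n` both sides
vanish (`complexGysin_cup_map_eq_zero_of_lt`), for `deg w > 2n` `w = 0`, and for `deg w = 2n` the
projection formula gives `snd^* b ∪ snd^*(fst_* snd^* w)` and `snd^* b ∪ (X ◁ fst)_*(snd^* snd^* w)`,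
whose degree-`0` factors are `ℂ`-linear in `w ∈ H²ⁿ(Z(ℂ)) ≅ ℂ`, multiples of `1`, the second one
non-zero for some `w` (`exists_complexGysin_map_ne_zero`), hence proportional with a ratio `c`
independent of `w`. [cite: Fulton1998, Prop. 1.7 and §16.1]
[cite: FultonYoungTableaux1997, Appendix B §B.1 (5)–(6)] [cite: HatcherAT2002, §3.2 Thm. 3.15] -/
theorem gysin_baseChange_of_kunneth (μ : OrientationFamily)
    (hX : IsSmoothProjective l X) (hY : IsSmoothProjective m Y) (hZ : IsSmoothProjective n Z)
    (hK : ∀ ⦃m' n' : ℕ⦄ ⦃Y' Z' : SchemeOver ℂ⦄, IsSmoothProjective m' Y' → IsSmoothProjective n' Z' →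
      ∀ (k : ℕ) (z : complexBetti (Y' ⊗ Z') k), z ∈ Submodule.span ℂ
        {v | ∃ (i j : ℕ) (h : i + j = k) (b : complexBetti Y' i) (w : complexBetti Z' j),
          v = cupProduct h (complexBetti.map (fst Y' Z') i b) (complexBetti.map (snd Y' Z') j w)})
    {k k₁ : ℕ} (hk : k + 2 * m = k₁ + 2 * (m + n)) :
    ∃ c : ℂ, ∀ z : complexBetti (Y ⊗ Z) k,
      complexBetti.map (snd X Y) k₁
        (complexGysin μ (IsSmoothProjective.tensor_holds hY hZ) hY (fst Y Z) hk z) =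
      c • complexGysin μ
          (IsSmoothProjective.tensor_holds hX (IsSmoothProjective.tensor_holds hY hZ))
          (IsSmoothProjective.tensor_holds hX hY) (X ◁ fst Y Z)
          (show k + 2 * (l + m) = k₁ + 2 * (l + (m + n)) by omega)
          (complexBetti.map (snd X (Y ⊗ Z)) k z) := by
  have hμ : μ.HasPoincareDuality := OrientationFamily.hasPoincareDuality μ
  have hYZ := IsSmoothProjective.tensor_holds hY hZ
  have hXY := IsSmoothProjective.tensor_holds hX hY
  have hT := IsSmoothProjective.tensor_holds hX hYZ
  -- the two degree-`0` fibre integrals `A w = snd^*(fst_* snd^* w)`, `B w = (X ◁ fst)_*(snd^* snd^* w)`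
  let A : complexBetti Z (2 * n) →ₗ[ℂ] complexBetti (X ⊗ Y) 0 :=
    (complexBetti.map (snd X Y) 0).hom ∘ₗ
      complexGysin μ hYZ hY (fst Y Z) (show 2 * n + 2 * m = 0 + 2 * (m + n) by omega) ∘ₗ
      (complexBetti.map (snd Y Z) (2 * n)).hom
  let B : complexBetti Z (2 * n) →ₗ[ℂ] complexBetti (X ⊗ Y) 0 :=
    complexGysin μ hT hXY (X ◁ fst Y Z) (show 2 * n + 2 * (l + m) = 0 + 2 * (l + (m + n)) by omega) ∘ₗ
      (complexBetti.map (snd X (Y ⊗ Z)) (2 * n)).hom ∘ₗ (complexBetti.map (snd Y Z) (2 * n)).hom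
  obtain ⟨w₁, hw₁⟩ := exists_complexGysin_map_ne_zero μ hX hY hZ (hK hX hYZ _) (hK hY hZ _)
  have hBw₁ : B w₁ ≠ 0 := hw₁
  have hw₁0 : w₁ ≠ 0 := by
    rintro rfl
    exact hBw₁ (map_zero B)
  obtain ⟨α, hα⟩ := exists_eq_smul_one μ hXY (A w₁)
  obtain ⟨β, hβ⟩ := exists_eq_smul_one μ hXY (B w₁)
  have hβ0 : β ≠ 0 := by
    rintro rfl
    exact hBw₁ (by rw [hβ, zero_smul])
  -- `A = (α β⁻¹) • B` on the line `H²ⁿ(Z(ℂ)) = ℂ · w₁`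
  have hAB : ∀ w, A w = (α * β⁻¹) • B w := by
    intro w
    obtain ⟨t, rfl⟩ := exists_eq_smul_of_top μ hZ hw₁0 w
    simp only [map_smul, hα, hβ, smul_smul]
    congr 1
    field_simp
  refine ⟨α * β⁻¹, fun z ↦ ?_⟩
  -- both sides are linear in `z`: check on cross products
  let F : complexBetti (Y ⊗ Z) k →ₗ[ℂ] complexBetti (X ⊗ Y) k₁ :=
    (complexBetti.map (snd X Y) k₁).hom ∘ₗ complexGysin μ hYZ hY (fst Y Z) hk
  let G : complexBetti (Y ⊗ Z) k →ₗ[ℂ] complexBetti (X ⊗ Y) k₁ :=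
    (α * β⁻¹) • (complexGysin μ hT hXY (X ◁ fst Y Z)
      (show k + 2 * (l + m) = k₁ + 2 * (l + (m + n)) by omega) ∘ₗ
      (complexBetti.map (snd X (Y ⊗ Z)) k).hom)
  change F z = G z
  refine LinearMap.eqOn_span (f := F) (g := G) ?_ (hK hY hZ k z)
  rintro _ ⟨i, j, hij, b, w, rfl⟩
  change complexBetti.map (snd X Y) k₁ (complexGysin μ hYZ hY (fst Y Z) hk
      (cupProduct hij (complexBetti.map (fst Y Z) i b) (complexBetti.map (snd Y Z) j w))) =
    (α * β⁻¹) • complexGysin μ hT hXY (X ◁ fst Y Z) _ (complexBetti.map (snd X (Y ⊗ Z)) k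
      (cupProduct hij (complexBetti.map (fst Y Z) i b) (complexBetti.map (snd Y Z) j w)))
  -- `snd^*(fst^* b ∪ snd^* w) = (X ◁ fst)^* snd^* b ∪ snd^* snd^* w` on `X ⊗ (Y ⊗ Z)`
  have epull : complexBetti.map (snd X (Y ⊗ Z)) k
      (cupProduct hij (complexBetti.map (fst Y Z) i b) (complexBetti.map (snd Y Z) j w)) =
      cupProduct hij (complexBetti.map (X ◁ fst Y Z) i (complexBetti.map (snd X Y) i b))
        (complexBetti.map (snd X (Y ⊗ Z)) j (complexBetti.map (snd Y Z) j w)) := by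
    rw [cupProduct_map, ← CategoryTheory.comp_apply (f := complexBetti.map (fst Y Z) i),
      ← complexBetti.map_comp, ← whiskerLeft_snd, complexBetti.map_comp, CategoryTheory.comp_apply]
  rw [epull]
  rcases lt_trichotomy j (2 * n) with hj | hj | hj
  · -- below the fibre dimension both sides vanish
    rw [complexGysin_cup_map_eq_zero_of_lt hYZ hY (fst Y Z) hij hk (by omega) b,
      complexGysin_cup_map_eq_zero_of_lt hT hXY (X ◁ fst Y Z) hij _ (by omega), map_zero, smul_zero]
  swap
  · haveI := subsingleton_complexBetti hZ hj
    rw [Subsingleton.elim w 0, map_zero, map_zero, map_zero, map_zero, map_zero, map_zero, map_zero,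
      smul_zero]
  subst hj
  obtain rfl : i = k₁ := by omega
  -- projection formula on both sides
  rw [complexGysin_cup hμ hYZ hY (fst Y Z) hij hk (show 2 * n + 2 * m = 0 + 2 * (m + n) by omega)
      (Nat.add_zero _) b, cupProduct_map,
    complexGysin_cup hμ hT hXY (X ◁ fst Y Z) hij _
      (show 2 * n + 2 * (l + m) = 0 + 2 * (l + (m + n)) by omega) (Nat.add_zero _)]
  change cupProduct _ (complexBetti.map (snd X Y) i b) (A w) =
    (α * β⁻¹) • cupProduct _ (complexBetti.map (snd X Y) i b) (B w)
  rw [hAB w, map_smul]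

end HodgeTheory

end Literature.AlgebraicGeometry.HodgeTheory

end
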